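import Literature.AlgebraicGeometry.Frobenioids.DivisorMonoidCategoryTheoreticityFacts
import Literature.AlgebraicGeometry.Frobenioids.Cor411iiOfThm34ii
import Literature.AlgebraicGeometry.Frobenioids.EquivalencePreStepsFSMFF2008Assembly
import HarnessLib

/-!
# Frobenioids I, §4: the named fact `FrdI.Cor411ii` — [FrdI] Corollary 4.11 (ii) — HOLDS (2008 wording, no
# revision of "FSMFF-type", every pair of Frobenioids with `Φ_i` perf-factorial)

Mochizuki, *The geometry of Frobenioids I: the general theory*, Kyushu J. Math. **62** (2008) 293–400,
§4, Corollary 4.11 (ii), kurims p. 91: for `Φ_i` perf-factorial divisorial monoids on connected, totally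
epimorphic, Div-slim `D_i`, `C_i → F_{Φ_i}` Frobenioids of standard type and an equivalence `Ψ : C₁ ⥲ C₂`
(with hypothesis (b) in the group-like case), "there exists a 1-unique functor `Ψ^Base : D₁ → D₂` that fits
into a 1-commutative diagram [over `Ψ`] … Moreover, if `D₁`, `D₂` are slim, then each of the composite
functors … is rigid"; proof pp. 92–94 [cite: MochizukiFrdI2008, Cor. 4.11 (ii) p.91]; Thm. 3.4 (ii) p. 62
[cite: MochizukiFrdI2008, Thm. 3.4 (ii) p.62]; the author's *Comments* (Jan. 2024) (29)(v) (amended first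
paragraph of the proof: the route through `(C^istr)^un-tr`).

PROOF-ONLY companion of `DivisorMonoidCategoryTheoreticityFacts.lean` (seat abc-iut-L1-t2: the 0-ary named
fact `FrdI.Cor411ii`, FACT-LIST row F-0715, DAG node `FrdI:Cor4.11(ii)` — "the most cited item of [FrdI] in
IUT"); cell abc-iut, seat abc-iut-f-037. No definitions; the fact is imported, never restated; the closing
theorem states its FULLY-QUALIFIED type. This file declares ONLY the 0-ary closer: the per-instance form
`FrdI.cor411ii_ofFunctor` is seat abc-iut-L1-d6's (`Cor411AsPrinted.lean`) and is the same term.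

Assembly (two landed inputs, consumed BY NAME):
* `PreFrobenioid.cor411ii_ofFunctor_of_thm34ii` (`Cor411iiOfThm34ii.lean`, seat abc-iut-L1-d6; over the
  un-tr route `Cor411iiAssemblyFSM` / `Cor411iiOfPreSteps` of the same seat and the §4 chain of seats
  abc-iut-w4-d105 / L1-t11 / L1-t13 / L1-t14 / w5 lineages): the typed `(ofFunctor Φ₁ F₁).Cor411ii
  (ofFunctor Φ₂ F₂) Ψ` from the typed Thm. 3.4 (ii) for `Ψ` AND for `Ψ⁻¹`;
* `FrdI.thm34ii_ofFunctor` (`EquivalencePreStepsFSMFF2008Assembly.lean`, seat abc-iut-L1-t11, over the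
  isotropic core `EquivalencePreStepsFSMFF2008.lean` of seat abc-iut-L1-t13): the typed Thm. 3.4 (ii)
  `(ofFunctor Φ₁ F₁).Thm34ii (ofFunctor Φ₂ F₂) Ψ` for EVERY pair of Frobenioids and every `Ψ` — bases of
  FSMFF-type in the PRINTED (2008) sense, as recorded inside standard type (d).
Hence `FrdI.Cor411ii` holds outright, for every pair of Frobenioids `C_i → F_{Φ_i}` with `Φ_i`
perf-factorial and every equivalence `Ψ` (its own antecedent `Cor411Setting` — Div-slim, standard type,
(b) — being consumed and nothing else assumed). Nothing of the paper is restated or strengthened; nothing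
here bears on [IUTchIII] Cor. 3.12.
-/

namespace Literature.AlgebraicGeometry.Frobenioids

open CategoryTheory Opposite

universe w v v' u u'

namespace FrdI

/-- **The named fact [FrdI] Corollary 4.11 (ii) (`FrdI.Cor411ii`, FACT-LIST row F-0715) HOLDS** — 2008
wording ("FSMFF-type" as printed inside standard type (d)), `Φ_i` perf-factorial = objectwise
`IsPerfFactorial`, every pair of Frobenioids, every `Ψ`: `PreFrobenioid.cor411ii_ofFunctor_of_thm34ii` fed with
the typed Thm. 3.4 (ii) for `Ψ` and `Ψ⁻¹` (`FrdI.thm34ii_ofFunctor`). FULLY-QUALIFIED type.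
[cite: MochizukiFrdI2008, Cor. 4.11 (ii) p.91] -/
theorem Cor411ii_holds : Literature.AlgebraicGeometry.Frobenioids.FrdI.Cor411ii.{w, v, v', u, u'} :=
  fun _ _ hF₁ hF₂ hpf₁ hpf₂ Ψ =>
    PreFrobenioid.cor411ii_ofFunctor_of_thm34ii hF₁ hF₂ Ψ hpf₁ hpf₂ (thm34ii_ofFunctor hF₁ hF₂ Ψ)
      (thm34ii_ofFunctor hF₂ hF₁ Ψ.symm)

end FrdI

end Literature.AlgebraicGeometry.Frobenioids
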